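import Summits.AtomisticToContinuum.FouriersLaw.Theorems.HiddenChargeMazurDressedChargeMainReductionAux2

/-!
# Main reduction for stub S1 of crux `DressedCharge` — helper 3: the linearised equation of the
# pinned anharmonic chain

Crux stmt-AtomisticToContinuum-13509 (`HiddenChargeMazur.DressedCharge`), line `birth`, stub G
`stub_mainReduction` (lead). The generator assignment of the Liouville derivation of `pinnedChain`
(`q_x ↦ p_x`, `p_x ↦ F_x = -(a q_x + b q_x³) + ((q_{x+1}-q_x) + c (q_{x+1}-q_x)³) - ((q_x-q_{x-1}) + c (q_x-q_{x-1})³)`,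
`(a,b,c) = (ω₂, lam, β)`) is shift-equivariant, nearest-neighbour, momentum-free and reversal-odd; its
anchored Hessian row is computed; and from a local conservation law `L G = Ψ - τΨ` the discrete Euler
operators `u = E_p G`, `v = E_q G` (window `[-M, M]`) satisfy `v = -L u` and the LINEARISED EQUATION
`L (L u) + (W₀₀ u + W₀₁ τu + W₀₋₁ τ⁻¹u) = 0`; if `G` is momentum-odd then `u` is momentum-even.
No definitions, no notation.
-/

noncomputable section

namespace Summit.AtomisticToContinuum.FouriersLaw.Theorems.DressedCharge

open MvPolynomial

variable {R : Type*} [CommRing R]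

/-! ## The force assignment of the pinned anharmonic chain -/

section Force

variable (a b c : R) (h : ℤ ⊕ ℤ → MvPolynomial (ℤ ⊕ ℤ) R)
  (hh : h = Sum.elim (fun i : ℤ => (X (Sum.inr i) : MvPolynomial (ℤ ⊕ ℤ) R))
    (fun i : ℤ => -(C a * X (Sum.inl i) + C b * X (Sum.inl i) ^ 3)
      + ((X (Sum.inl (i + 1)) - X (Sum.inl i)) + C c * (X (Sum.inl (i + 1)) - X (Sum.inl i)) ^ 3)
      - ((X (Sum.inl i) - X (Sum.inl (i - 1))) + C c * (X (Sum.inl i) - X (Sum.inl (i - 1))) ^ 3)))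
include hh

/-- `L q_i = p_i`. -/
theorem force_inl (i : ℤ) : h (Sum.inl i) = X (Sum.inr i) := by
  subst hh; rfl

/-- `L p_i = F_i`. -/
theorem force_inr (i : ℤ) : h (Sum.inr i) = -(C a * X (Sum.inl i) + C b * X (Sum.inl i) ^ 3)
      + ((X (Sum.inl (i + 1)) - X (Sum.inl i)) + C c * (X (Sum.inl (i + 1)) - X (Sum.inl i)) ^ 3)
      - ((X (Sum.inl i) - X (Sum.inl (i - 1))) + C c * (X (Sum.inl i) - X (Sum.inl (i - 1))) ^ 3) := by
  subst hh; rfl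

/-- The force is momentum-free. -/
theorem force_pure (i k : ℤ) : pderiv (Sum.inr k) (h (Sum.inr i)) = 0 := by
  rw [force_inr a b c h hh]
  simp [pderiv_X, Derivation.leibniz_pow]

/-- The force assignment is shift-equivariant. -/
theorem force_equiv (j : ℤ) (v : ℤ ⊕ ℤ) :
    rename (Sum.map (fun i : ℤ => i + j) (fun i : ℤ => i + j)) (h v) =
      h (Sum.map (fun i : ℤ => i + j) (fun i : ℤ => i + j) v) := by
  rcases v with i | i
  · simp [force_inl a b c h hh]
  · simp only [Sum.map_inr, force_inr a b c h hh, map_add, map_sub, map_neg, map_mul, map_pow, rename_C,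
      rename_X, Sum.map_inl]
    rw [show i + j + 1 = i + 1 + j by ring, show i + j - 1 = i - 1 + j by ring]

/-- The position generator image `p_i` is reversal-odd. -/
theorem force_theta_inl (i : ℤ) :
    MvPolynomial.aeval (R := R) (Sum.elim (fun i : ℤ => (X (Sum.inl i) : MvPolynomial (ℤ ⊕ ℤ) R))
      (fun i : ℤ => -X (Sum.inr i))) (h (Sum.inl i)) = -h (Sum.inl i) := by
  rw [force_inl a b c h hh, theta_X_inr]

/-- The force `F_i` is reversal-even. -/
theorem force_theta_inr (i : ℤ) :
    MvPolynomial.aeval (R := R) (Sum.elim (fun i : ℤ => (X (Sum.inl i) : MvPolynomial (ℤ ⊕ ℤ) R))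
      (fun i : ℤ => -X (Sum.inr i))) (h (Sum.inr i)) = h (Sum.inr i) := by
  rw [force_inr a b c h hh]
  simp only [map_add, map_sub, map_neg, map_mul, map_pow, theta_C, theta_X_inl]

/-- `∂_{q_k} F_i` for the three neighbours and zero otherwise: the nearest-neighbour property. -/
theorem force_nn (i k : ℤ) (h1 : i ≠ k - 1) (h2 : i ≠ k) (h3 : i ≠ k + 1) :
    pderiv (Sum.inl k) (h (Sum.inr i)) = 0 := by
  rw [force_inr a b c h hh]
  have e1 : (Sum.inl i : ℤ ⊕ ℤ) ≠ Sum.inl k := by simpa using h2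
  have e2 : (Sum.inl (i + 1) : ℤ ⊕ ℤ) ≠ Sum.inl k := by simp; omega
  have e3 : (Sum.inl (i - 1) : ℤ ⊕ ℤ) ≠ Sum.inl k := by simp; omega
  simp [pderiv_X, Derivation.leibniz_pow, e1, e2, e3]

/-- Anchored Hessian entry `∂_{q_0} F_{-1} = 1 + 3c (q_0 - q_{-1})²`. -/
theorem force_hess_neg_one :
    pderiv (Sum.inl 0) (h (Sum.inr (-1))) = 1 + C (3 * c) * (X (Sum.inl 0) - X (Sum.inl (-1))) ^ 2 := by
  rw [force_inr a b c h hh]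
  have e1 : (Sum.inl (-1 : ℤ) : ℤ ⊕ ℤ) ≠ Sum.inl 0 := by simp
  have e2 : (Sum.inl (-1 - 1 : ℤ) : ℤ ⊕ ℤ) ≠ Sum.inl 0 := by simp
  simp only [map_add, map_sub, map_neg, Derivation.leibniz, Derivation.leibniz_pow, pderiv_C, pderiv_X,
    smul_eq_mul, Pi.single_apply, e1, e2, if_false, show (-1 : ℤ) + 1 = 0 by norm_num, if_true, map_mul]
  simp [map_ofNat]
  ring

/-- Anchored Hessian entry `∂_{q_0} F_0 = -(a + 3b q_0²) - (1 + 3c (q_1-q_0)²) - (1 + 3c (q_0-q_{-1})²)`. -/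
theorem force_hess_zero :
    pderiv (Sum.inl 0) (h (Sum.inr 0)) = -(C a + C (3 * b) * X (Sum.inl 0) ^ 2)
      - (1 + C (3 * c) * (X (Sum.inl 1) - X (Sum.inl 0)) ^ 2)
      - (1 + C (3 * c) * (X (Sum.inl 0) - X (Sum.inl (-1))) ^ 2) := by
  rw [force_inr a b c h hh]
  have e1 : (Sum.inl (0 + 1 : ℤ) : ℤ ⊕ ℤ) ≠ Sum.inl 0 := by simp
  have e2 : (Sum.inl (0 - 1 : ℤ) : ℤ ⊕ ℤ) ≠ Sum.inl 0 := by simp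
  simp only [map_add, map_sub, map_neg, Derivation.leibniz, Derivation.leibniz_pow, pderiv_C, pderiv_X,
    smul_eq_mul, Pi.single_apply, e1, e2, if_false, if_true, map_mul]
  simp [map_ofNat]
  ring

/-- Anchored Hessian entry `∂_{q_0} F_1 = 1 + 3c (q_1 - q_0)²`. -/
theorem force_hess_one :
    pderiv (Sum.inl 0) (h (Sum.inr 1)) = 1 + C (3 * c) * (X (Sum.inl 1) - X (Sum.inl 0)) ^ 2 := by
  rw [force_inr a b c h hh]
  have e1 : (Sum.inl (1 : ℤ) : ℤ ⊕ ℤ) ≠ Sum.inl 0 := by simp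
  have e2 : (Sum.inl (1 + 1 : ℤ) : ℤ ⊕ ℤ) ≠ Sum.inl 0 := by simp
  simp only [map_add, map_sub, map_neg, Derivation.leibniz, Derivation.leibniz_pow, pderiv_C, pderiv_X,
    smul_eq_mul, Pi.single_apply, e1, e2, if_false, show (1 : ℤ) - 1 = 0 by norm_num, if_true, map_mul]
  simp [map_ofNat]
  ring

end Force


/-! ## The linearised equation from a local conservation law -/

/-- Window sums of a coboundary vanish: `E^S_ι (Ψ - τΨ) = 0` for windows containing the support of `Ψ`
with margin (both for `ι = inr` (momenta) and `ι = inl` (positions)). -/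
theorem window_sum_coboundary (M : ℕ) (Ψ : MvPolynomial (ℤ ⊕ ℤ) R)
    (hΨ : ∀ v ∈ Ψ.vars, Sum.elim id id v ∈ Set.Icc (-(M : ℤ)) M) :
    (∑ k ∈ Finset.Icc (-(M : ℤ) - 1) (M + 1), rename (Sum.map (fun i : ℤ => i + -k) (fun i : ℤ => i + -k))
        (pderiv (Sum.inr k) (Ψ - rename (Sum.map (fun i : ℤ => i + 1) (fun i : ℤ => i + 1)) Ψ)) = 0) ∧
    (∑ k ∈ Finset.Icc (-(M : ℤ) - 1) (M + 1), rename (Sum.map (fun i : ℤ => i + -k) (fun i : ℤ => i + -k))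
        (pderiv (Sum.inl k) (Ψ - rename (Sum.map (fun i : ℤ => i + 1) (fun i : ℤ => i + 1)) Ψ)) = 0) := by
  have hwin : ∀ (ι : ℤ → ℤ ⊕ ℤ), (∀ k, Sum.elim id id (ι k) = k) → ∀ k, ι k ∈ Ψ.vars →
      k ∈ Finset.Icc (-(M : ℤ) - 1) (M + 1) ∧ k ∈ (Finset.Icc (-(M : ℤ) - 1) (M + 1)).image (fun k => k - 1) := by
    intro ι hι k hk
    have hb := hΨ _ hk
    rw [hι] at hb
    simp only [Set.mem_Icc] at hb
    refine ⟨Finset.mem_Icc.mpr ⟨by omega, by omega⟩, Finset.mem_image.mpr ⟨k + 1, Finset.mem_Icc.mpr ⟨by omega, by omega⟩, by ring⟩⟩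
  constructor
  · simp only [map_sub, Finset.sum_sub_distrib, eulerP_sum_shift]
    rw [sub_eq_zero]
    exact window_sum_indep Sum.inr (fun k => rename (Sum.map (fun i : ℤ => i + -k) (fun i : ℤ => i + -k))) _ _ Ψ
      (fun k hk => (hwin Sum.inr (fun _ => rfl) k hk).1) (fun k hk => (hwin Sum.inr (fun _ => rfl) k hk).2)
  · simp only [map_sub, Finset.sum_sub_distrib, eulerQ_sum_shift]
    rw [sub_eq_zero]
    exact window_sum_indep Sum.inl (fun k => rename (Sum.map (fun i : ℤ => i + -k) (fun i : ℤ => i + -k))) _ _ Ψ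
      (fun k hk => (hwin Sum.inl (fun _ => rfl) k hk).1) (fun k hk => (hwin Sum.inl (fun _ => rfl) k hk).2)

/-- **The linearised equation.** From a local conservation law `L G = Ψ - τΨ` of the pinned anharmonic
chain (`L = mkDerivation R h`, `h` the force assignment with parameters `(a,b,c) = (ω₂, lam, β)`), the
discrete Euler operators `u = E_p G = Σ_{|k| ≤ M+1} τ^{-k} ∂_{p_k} G` and `v = E_q G` satisfy `v = -L u` and
`L (L u) + (W₀₀ u + W₀₁ τu + W₀₋₁ τ⁻¹ u) = 0` with the anchored Hessian row
`W₀₀ = a + 3b q₀² + (1 + 3c (q₁-q₀)²) + (1 + 3c (q₀-q₋₁)²)`, `W₀,±₁ = -(1 + 3c (q_{±1} - q₀)²)`. -/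
theorem linearised_of_law (a b c : R) (h : ℤ ⊕ ℤ → MvPolynomial (ℤ ⊕ ℤ) R)
    (hh : h = Sum.elim (fun i : ℤ => (X (Sum.inr i) : MvPolynomial (ℤ ⊕ ℤ) R))
      (fun i : ℤ => -(C a * X (Sum.inl i) + C b * X (Sum.inl i) ^ 3)
        + ((X (Sum.inl (i + 1)) - X (Sum.inl i)) + C c * (X (Sum.inl (i + 1)) - X (Sum.inl i)) ^ 3)
        - ((X (Sum.inl i) - X (Sum.inl (i - 1))) + C c * (X (Sum.inl i) - X (Sum.inl (i - 1))) ^ 3)))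
    (G Ψ : MvPolynomial (ℤ ⊕ ℤ) R) (M : ℕ)
    (hG : ∀ v ∈ G.vars, Sum.elim id id v ∈ Set.Icc (-(M : ℤ)) M)
    (hΨ : ∀ v ∈ Ψ.vars, Sum.elim id id v ∈ Set.Icc (-(M : ℤ)) M)
    (hlaw : MvPolynomial.mkDerivation R h G = Ψ - rename (Sum.map (fun i : ℤ => i + 1) (fun i : ℤ => i + 1)) Ψ)
    (u v : MvPolynomial (ℤ ⊕ ℤ) R)
    (hu : u = ∑ k ∈ Finset.Icc (-(M : ℤ) - 1) (M + 1),
      rename (Sum.map (fun i : ℤ => i + -k) (fun i : ℤ => i + -k)) (pderiv (Sum.inr k) G))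
    (hv : v = ∑ k ∈ Finset.Icc (-(M : ℤ) - 1) (M + 1),
      rename (Sum.map (fun i : ℤ => i + -k) (fun i : ℤ => i + -k)) (pderiv (Sum.inl k) G)) :
    v = -MvPolynomial.mkDerivation R h u ∧
    MvPolynomial.mkDerivation R h (MvPolynomial.mkDerivation R h u) +
      ((C a + C (3 * b) * X (Sum.inl 0) ^ 2 + (1 + C (3 * c) * (X (Sum.inl 1) - X (Sum.inl 0)) ^ 2)
          + (1 + C (3 * c) * (X (Sum.inl 0) - X (Sum.inl (-1))) ^ 2)) * u
        + -(1 + C (3 * c) * (X (Sum.inl 1) - X (Sum.inl 0)) ^ 2) *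
            rename (Sum.map (fun i : ℤ => i + 1) (fun i : ℤ => i + 1)) u
        + -(1 + C (3 * c) * (X (Sum.inl 0) - X (Sum.inl (-1))) ^ 2) *
            rename (Sum.map (fun i : ℤ => i + -1) (fun i : ℤ => i + -1)) u) = 0 := by
  obtain ⟨hcobP, hcobQ⟩ := window_sum_coboundary M Ψ hΨ
  -- momentum Euler identity: `0 = v + L u`
  have hP := eulerP_liouville h (force_inl a b c h hh) (force_pure a b c h hh) (force_equiv a b c h hh)
    (Finset.Icc (-(M : ℤ) - 1) (M + 1)) G
  rw [hlaw, hcobP, ← hu, ← hv] at hP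
  have hv' : v = -MvPolynomial.mkDerivation R h u := by
    have := hP.symm
    rw [add_eq_zero_iff_eq_neg] at this
    exact this
  refine ⟨hv', ?_⟩
  -- position Euler identity: `0 = L v + Σ (∂_{q_0} F_m) τᵐ u`
  have hS : ∀ k, Sum.inr k ∈ G.vars → k - 1 ∈ Finset.Icc (-(M : ℤ) - 1) (M + 1) ∧
      k ∈ Finset.Icc (-(M : ℤ) - 1) (M + 1) ∧ k + 1 ∈ Finset.Icc (-(M : ℤ) - 1) (M + 1) := by
    intro k hk
    have hb := hG _ hk
    simp only [Sum.elim_inr, id_eq, Set.mem_Icc] at hb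
    exact ⟨Finset.mem_Icc.mpr ⟨by omega, by omega⟩, Finset.mem_Icc.mpr ⟨by omega, by omega⟩,
      Finset.mem_Icc.mpr ⟨by omega, by omega⟩⟩
  have hQ := eulerQ_liouville h (force_inl a b c h hh) (force_nn a b c h hh) (force_equiv a b c h hh)
    (Finset.Icc (-(M : ℤ) - 1) (M + 1)) G hS
  rw [hlaw, hcobQ, ← hu, ← hv, force_hess_neg_one a b c h hh, force_hess_zero a b c h hh,
    force_hess_one a b c h hh, hv', Derivation.map_neg] at hQ
  -- `0 = -L(Lu) + W'₋₁ τ⁻¹u + W'₀ u + W'₁ τu`; move everything across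
  have := hQ.symm
  rw [← neg_eq_zero, ← this]
  ring

/-- If `G` is momentum-odd then `u = E_p G` is momentum-even. -/
theorem eulerP_even_of_odd (G : MvPolynomial (ℤ ⊕ ℤ) R) (S : Finset ℤ)
    (hodd : MvPolynomial.aeval (R := R) (Sum.elim (fun i : ℤ => (X (Sum.inl i) : MvPolynomial (ℤ ⊕ ℤ) R))
      (fun i : ℤ => -X (Sum.inr i))) G = -G) :
    MvPolynomial.aeval (R := R) (Sum.elim (fun i : ℤ => (X (Sum.inl i) : MvPolynomial (ℤ ⊕ ℤ) R))
      (fun i : ℤ => -X (Sum.inr i)))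
      (∑ k ∈ S, rename (Sum.map (fun i : ℤ => i + -k) (fun i : ℤ => i + -k)) (pderiv (Sum.inr k) G)) =
    ∑ k ∈ S, rename (Sum.map (fun i : ℤ => i + -k) (fun i : ℤ => i + -k)) (pderiv (Sum.inr k) G) := by
  rw [map_sum]
  refine Finset.sum_congr rfl fun k _ => ?_
  rw [theta_shift]
  congr 1
  have h2 := pderiv_inr_theta k G
  rw [hodd, map_neg, neg_inj] at h2
  exact h2.symm

/-- ANCHOR of this helper file (registered sub-goal of the crux): the momentum Euler operator of a
momentum-odd real lattice polynomial is momentum-even. -/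
theorem mainReduction_eulerP_even_anchor_real :
    ∀ (G : MvPolynomial (ℤ ⊕ ℤ) ℝ) (S : Finset ℤ), MvPolynomial.aeval (Sum.elim (fun i : ℤ => (MvPolynomial.X (Sum.inl i) : MvPolynomial (ℤ ⊕ ℤ) ℝ)) (fun i : ℤ => -MvPolynomial.X (Sum.inr i))) G = -G → MvPolynomial.aeval (Sum.elim (fun i : ℤ => (MvPolynomial.X (Sum.inl i) : MvPolynomial (ℤ ⊕ ℤ) ℝ)) (fun i : ℤ => -MvPolynomial.X (Sum.inr i))) (∑ k ∈ S, MvPolynomial.rename (Sum.map (fun i : ℤ => i + -k) (fun i : ℤ => i + -k)) (MvPolynomial.pderiv (Sum.inr k) G)) = ∑ k ∈ S, MvPolynomial.rename (Sum.map (fun i : ℤ => i + -k) (fun i : ℤ => i + -k)) (MvPolynomial.pderiv (Sum.inr k) G) :=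
  fun G S hodd => eulerP_even_of_odd G S hodd

end Summit.AtomisticToContinuum.FouriersLaw.Theorems.DressedCharge

end
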